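import Literature.Combinatorics.SetFamily.CubeMiddleLayer
import Mathlib.LinearAlgebra.Dimension.Constructions
import Mathlib.LinearAlgebra.FiniteDimensional.Lemmas
import HarnessLib

/-!
# Subcubes over `(A choose d)`: exact intersection with the layer `{wt_A = d}`, and affine structure

Continuation of `CubeMiddleLayer.lean` (coordinate set `A`, `|A| = a = d + k`, members `Φ_S`,
`S ∈ (A choose d)`, layer `B = {wt_A = d}`):

* `mem_inter_Bset`: `x ∈ Φ_S ∩ B` iff `x` is `1` on `S` and `0` on `A ∖ S`; hence
  `card_Phi_inter_Bset : |Φ_S ∩ B| = 2^{n-a}` and the EXACT per-member loss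
  `loss_exact : 2^k·|Φ_S ∩ B| = |Φ_S|` (fraction `2^{-k}`), `card_PhiP_exact`;
* affine structure: `IsAffineFlatOfCodim X d` — `X` is a coset `a + W` of a linear subspace `W ≤ 𝔽₂ⁿ` with
  `dim W + d = n`; `Φ_S` is an affine flat of codimension `|S|` (`isAffineFlatOfCodim_Phi`, the coset
  `ind S + ker(restriction to S)`) and `Φ_S ∩ B` one of codimension `|A|` (`isAffineFlatOfCodim_inter_Bset`);
* `ind_mem_Phi_iff`: the multiplicity-one points `ind S` (no proper subfamily has the same union).

-- adapted from reserve/prior-2001/Prior/PneNP/PneNP/Pnp_Y3DaglikeReslinWidthAndLayerCounting_MiddleLayerCounterexample.lean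
-- (internal 2001 programme, route y3, manuscript "The middle layer of the cube refutes a union-stability
-- conjecture for affine subspaces", v2 6c855445, 2026-08; unpublished, NOT cited as a source anywhere in
-- the tree); proofs unchanged, namespace and docstrings adapted.
-/

namespace Literature.Combinatorics.SetFamily

open Finset

namespace CubeMiddleLayer

variable {n : ℕ}

/-- `X ⊆ 𝔽₂ⁿ` is an *affine flat (coset of a linear subspace) of codimension exactly `d`*: `X = a + W` for a
submodule `W` of `𝔽₂ⁿ = Fin n → ZMod 2` with `dim W + d = n` (so `X` is nonempty and `d ≤ n`). [folklore] -/
def IsAffineFlatOfCodim (X : Set (V n)) (d : ℕ) : Prop :=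
  ∃ (W : Submodule (ZMod 2) (V n)) (a : V n),
    X = (fun w => a + w) '' (W : Set (V n)) ∧ Module.finrank (ZMod 2) W + d = n

/-- Non-vacuity of `IsAffineFlatOfCodim`: the whole cube is an affine flat of codimension `0`. [folklore] -/
theorem isAffineFlatOfCodim_univ : IsAffineFlatOfCodim (Set.univ : Set (V n)) 0 := by
  refine ⟨⊤, 0, ?_, ?_⟩
  · ext x
    simp
  · rw [finrank_top, Module.finrank_pi, Fintype.card_fin, add_zero]

/-! ### The removed sets: `Φ_S ∩ B` is an affine subspace of codimension `|A|`,
of size `2^(n - |A|)` — so each member loses exactly the fraction `2^{-k}`. -/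

/-- If `S ⊆ A ∩ X` with `|S| = d` then `|A ∩ X| = d + |(A ∖ S) ∩ X|`. [folklore] -/
lemma card_inter_of_subset {A S X : Finset (Fin n)} {d : ℕ} (hSA : S ⊆ A) (hSd : S.card = d)
    (hSX : S ⊆ X) : (A ∩ X).card = d + ((A \ S) ∩ X).card := by
  have e : A ∩ X = S ∪ ((A \ S) ∩ X) := by
    ext i
    simp only [Finset.mem_inter, Finset.mem_union, Finset.mem_sdiff]
    constructor
    · rintro ⟨hiA, hiX⟩
      by_cases hiS : i ∈ S
      · exact Or.inl hiS
      · exact Or.inr ⟨⟨hiA, hiS⟩, hiX⟩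
    · rintro (hiS | ⟨⟨hiA, _⟩, hiX⟩)
      · exact ⟨hSA hiS, hSX hiS⟩
      · exact ⟨hiA, hiX⟩
  have hdisj : Disjoint S ((A \ S) ∩ X) := by
    refine Finset.disjoint_left.mpr (fun i hiS hi => ?_)
    exact (Finset.mem_sdiff.mp (Finset.mem_inter.mp hi).1).2 hiS
  rw [e, Finset.card_union_of_disjoint hdisj, hSd]

/-- Membership description of the removed set: `x ∈ Φ_S ∩ B` iff `x` is 1 on `S` and 0 on
`A \ S`. [folklore] -/
lemma mem_inter_Bset {A S : Finset (Fin n)} {d : ℕ} (hSA : S ⊆ A) (hSd : S.card = d)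
    {x : V n} : x ∈ Phi S ∩ Bset A d ↔ (∀ j ∈ S, x j = 1) ∧ ∀ j ∈ A \ S, x j = 0 := by
  rw [Finset.mem_inter, mem_Bset, wtOn_eq_card_inter]
  constructor
  · rintro ⟨hxPhi, hcard⟩
    have hSsub : S ⊆ supp x := mem_Phi.mp hxPhi
    have hsplit := card_inter_of_subset hSA hSd hSsub
    have hzero : ((A \ S) ∩ supp x).card = 0 := by omega
    have hempty : (A \ S) ∩ supp x = ∅ := Finset.card_eq_zero.mp hzero
    refine ⟨fun j hj => mem_supp.mp (hSsub hj), fun j hj => ?_⟩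
    rcases zmod2_cases (x j) with h | h
    · exact h
    · exfalso
      have : j ∈ (A \ S) ∩ supp x := Finset.mem_inter.mpr ⟨hj, mem_supp.mpr h⟩
      simp [hempty] at this
  · rintro ⟨hone, hzero⟩
    have hxPhi : x ∈ Phi S := by
      refine Finset.mem_filter.mpr ⟨Finset.mem_univ _, hone⟩
    have hSsub : S ⊆ supp x := mem_Phi.mp hxPhi
    have hsplit := card_inter_of_subset hSA hSd hSsub
    have hempty : (A \ S) ∩ supp x = ∅ := by
      ext j
      simp only [Finset.mem_inter, mem_supp, Finset.notMem_empty, iff_false, not_and]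
      intro hj hx1
      rw [hzero j hj] at hx1
      exact absurd hx1 (by decide)
    rw [hempty] at hsplit
    refine ⟨hxPhi, ?_⟩
    simpa using hsplit

/-- `|Φ_S ∩ B| = 2^(n - |A|)` for every `S ∈ powersetCard d A`. [folklore] -/
theorem card_Phi_inter_Bset (A S : Finset (Fin n)) (d : ℕ)
    (hSA : S ⊆ A) (hSd : S.card = d) :
    (Phi S ∩ Bset A d).card = 2 ^ (n - A.card) := by
  have e : Phi S ∩ Bset A d = Finset.univ.filter
      (fun x : V n => S ⊆ supp x ∧ (A \ S) ∩ supp x = ∅) := by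
    ext x
    rw [mem_inter_Bset hSA hSd]
    simp only [Finset.mem_filter, Finset.mem_univ, true_and]
    constructor
    · rintro ⟨hone, hzero⟩
      refine ⟨fun j hj => mem_supp.mpr (hone j hj), ?_⟩
      ext j
      simp only [Finset.mem_inter, mem_supp, Finset.notMem_empty, iff_false, not_and]
      intro hj hx1
      rw [hzero j hj] at hx1
      exact absurd hx1 (by decide)
    · rintro ⟨hsub, hempty⟩
      refine ⟨fun j hj => mem_supp.mp (hsub hj), fun j hj => ?_⟩
      rcases zmod2_cases (x j) with h | h
      · exact h
      · exfalso
        have : j ∈ (A \ S) ∩ supp x := Finset.mem_inter.mpr ⟨hj, mem_supp.mpr h⟩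
        simp [hempty] at this
  rw [e, show (Finset.univ.filter
        (fun x : V n => S ⊆ supp x ∧ (A \ S) ∩ supp x = ∅)).card
      = (Finset.univ.filter
          (fun X : Finset (Fin n) => S ⊆ X ∧ (A \ S) ∩ X = ∅)).card from
    card_filter_supp (fun X => S ⊆ X ∧ (A \ S) ∩ X = ∅)]
  have htarget : (Finset.univ \ A).powerset.card = 2 ^ (n - A.card) := by
    rw [Finset.card_powerset, Finset.card_sdiff_of_subset (Finset.subset_univ A),
      Finset.card_univ, Fintype.card_fin]
  rw [← htarget]
  apply Finset.card_bij' (i := fun X _ => X \ A) (j := fun P _ => S ∪ P)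
  · intro X hX
    exact Finset.mem_powerset.mpr (Finset.sdiff_subset_sdiff (Finset.subset_univ X) le_rfl)
  · intro P hP
    have hPA : ∀ i ∈ P, i ∉ A := fun i hi =>
      (Finset.mem_sdiff.mp ((Finset.mem_powerset.mp hP) hi)).2
    refine Finset.mem_filter.mpr ⟨Finset.mem_univ _, Finset.subset_union_left, ?_⟩
    ext i
    simp only [Finset.mem_inter, Finset.mem_sdiff, Finset.mem_union,
      Finset.notMem_empty, iff_false, not_and]
    rintro ⟨hiA, hiS⟩ (hiS' | hiP)
    · exact hiS hiS'
    · exact hPA i hiP hiA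
  · intro X hX
    obtain ⟨-, hSX, hempty⟩ := Finset.mem_filter.mp hX
    ext i
    simp only [Finset.mem_union, Finset.mem_sdiff]
    constructor
    · rintro (hiS | ⟨hiX, -⟩)
      · exact hSX hiS
      · exact hiX
    · intro hiX
      by_cases hiA : i ∈ A
      · by_cases hiS : i ∈ S
        · exact Or.inl hiS
        · exfalso
          have : i ∈ (A \ S) ∩ X := Finset.mem_inter.mpr ⟨Finset.mem_sdiff.mpr ⟨hiA, hiS⟩, hiX⟩
          simp [hempty] at this
      · exact Or.inr ⟨hiX, hiA⟩
  · intro P hP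
    have hPA : ∀ i ∈ P, i ∉ A := fun i hi =>
      (Finset.mem_sdiff.mp ((Finset.mem_powerset.mp hP) hi)).2
    ext i
    simp only [Finset.mem_sdiff, Finset.mem_union]
    constructor
    · rintro ⟨hiS | hiP, hiA⟩
      · exact absurd (hSA hiS) hiA
      · exact hiP
    · intro hiP
      exact ⟨Or.inr hiP, hPA i hiP⟩

/-- Each member loses exactly the fraction `2^{-k}`:
`2^k · |Φ_S ∩ B| = |Φ_S|` when `|A| = d + k` (denominators cleared). [folklore] -/
theorem loss_exact (A S : Finset (Fin n)) (d k : ℕ) (hA : A.card = d + k)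
    (hSA : S ⊆ A) (hSd : S.card = d) :
    2 ^ k * (Phi S ∩ Bset A d).card = (Phi S).card := by
  have han : A.card ≤ n := card_le_univ_n A
  rw [card_Phi_inter_Bset A S d hSA hSd, card_Phi, hSd, hA, ← pow_add]
  congr 1
  omega

/-- `|Φ'_S| + |Φ_S ∩ B| = |Φ_S|`. [folklore] -/
lemma card_PhiP_add (A S : Finset (Fin n)) (d : ℕ) :
    (PhiP A d S).card + (Phi S ∩ Bset A d).card = (Phi S).card :=
  Finset.card_sdiff_add_card_inter _ _

/-- `|Φ'_S| = (1 - 2^{-k})·|Φ_S|`, cleared of denominators and subtraction-free: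
`2^k · |Φ'_S| + |Φ_S| = 2^k · |Φ_S|`. [folklore] -/
theorem card_PhiP_exact (A S : Finset (Fin n)) (d k : ℕ) (hA : A.card = d + k)
    (hSA : S ⊆ A) (hSd : S.card = d) :
    2 ^ k * (PhiP A d S).card + (Phi S).card = 2 ^ k * (Phi S).card := by
  calc 2 ^ k * (PhiP A d S).card + (Phi S).card
      = 2 ^ k * (PhiP A d S).card + 2 ^ k * (Phi S ∩ Bset A d).card := by
        rw [loss_exact A S d k hA hSA hSd]
  _ = 2 ^ k * ((PhiP A d S).card + (Phi S ∩ Bset A d).card) := by ring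
  _ = 2 ^ k * (Phi S).card := by rw [card_PhiP_add]

/-! ### Affine structure: members have codimension `d`, removed sets codimension `|A|` -/


/-- The kernel of restriction to `A` has finrank `n - |A|` (with `|A| ≤ n`, stated additively). [folklore] -/
lemma finrank_ker_restrict (A : Finset (Fin n)) :
    Module.finrank (ZMod 2)
        (LinearMap.ker (LinearMap.funLeft (ZMod 2) (ZMod 2)
          (fun j : { j // j ∈ A } => (j : Fin n)))) + A.card = n := by
  have hsurj : Function.Surjective
      (LinearMap.funLeft (ZMod 2) (ZMod 2) (fun j : { j // j ∈ A } => (j : Fin n))) :=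
    LinearMap.funLeft_surjective_of_injective _ _ _ Subtype.val_injective
  have hdom : Module.finrank (ZMod 2) (V n) = n := by
    rw [Module.finrank_pi, Fintype.card_fin]
  have hcod : Module.finrank (ZMod 2) ({ j // j ∈ A } → ZMod 2) = A.card := by
    rw [Module.finrank_pi, Fintype.card_coe]
  have hrn := LinearMap.finrank_range_add_finrank_ker
    (LinearMap.funLeft (ZMod 2) (ZMod 2) (fun j : { j // j ∈ A } => (j : Fin n)))
  rw [LinearMap.range_eq_top.mpr hsurj, finrank_top, hcod, hdom] at hrn
  omega

/-- The member `Φ_S` is an affine subspace of codimension `|S|` (structural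
form): it is the coset `ind S + ker(restriction to S)`. [folklore] -/
theorem isAffineFlatOfCodim_Phi (S : Finset (Fin n)) :
    IsAffineFlatOfCodim (↑(Phi S) : Set (V n)) S.card := by
  set f : V n →ₗ[ZMod 2] ({ j // j ∈ S } → ZMod 2) :=
    LinearMap.funLeft (ZMod 2) (ZMod 2) (fun j => (j : Fin n)) with hf
  refine ⟨LinearMap.ker f, ind S, ?_, finrank_ker_restrict S⟩
  ext x
  simp only [Set.mem_image, SetLike.mem_coe, LinearMap.mem_ker]
  constructor
  · intro hx
    have hx' : ∀ j ∈ S, x j = 1 := by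
      intro j hj
      exact (Finset.mem_filter.mp hx).2 j hj
    refine ⟨ind S + x, ?_, ?_⟩
    · rw [hf]
      funext j
      rw [LinearMap.funLeft_apply, Pi.zero_apply, Pi.add_apply]
      have hj : (j : Fin n) ∈ S := j.2
      rw [show ind S (j : Fin n) = 1 from by simp [ind, hj], hx' _ hj]
      exact (by decide : (1 : ZMod 2) + 1 = 0)
    · funext i
      exact (by decide : ∀ a b : ZMod 2, a + (a + b) = b) (ind S i) (x i)
  · rintro ⟨w, hw, rfl⟩
    refine Finset.mem_filter.mpr ⟨Finset.mem_univ _, fun j hj => ?_⟩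
    have hwj : w j = 0 := by
      have := congrFun hw ⟨j, hj⟩
      rwa [LinearMap.funLeft_apply] at this
    simp only [Pi.add_apply, ind, if_pos hj, hwj, add_zero]

/-- The removed set `Φ_S ∩ B` is an affine subspace of codimension `|A|` (structural form): the
coset `ind S + ker(restriction to A)`. [folklore] -/
theorem isAffineFlatOfCodim_inter_Bset (A S : Finset (Fin n)) (d : ℕ)
    (hSA : S ⊆ A) (hSd : S.card = d) :
    IsAffineFlatOfCodim (↑(Phi S ∩ Bset A d) : Set (V n)) A.card := by
  set f : V n →ₗ[ZMod 2] ({ j // j ∈ A } → ZMod 2) :=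
    LinearMap.funLeft (ZMod 2) (ZMod 2) (fun j => (j : Fin n)) with hf
  refine ⟨LinearMap.ker f, ind S, ?_, finrank_ker_restrict A⟩
  ext x
  simp only [Set.mem_image, SetLike.mem_coe, LinearMap.mem_ker]
  rw [mem_inter_Bset hSA hSd]
  constructor
  · rintro ⟨hone, hzero⟩
    refine ⟨ind S + x, ?_, ?_⟩
    · rw [hf]
      funext j
      rw [LinearMap.funLeft_apply, Pi.zero_apply, Pi.add_apply]
      have hjA : (j : Fin n) ∈ A := j.2
      by_cases hjS : (j : Fin n) ∈ S
      · rw [show ind S (j : Fin n) = 1 from by simp [ind, hjS], hone _ hjS]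
        exact (by decide : (1 : ZMod 2) + 1 = 0)
      · rw [show ind S (j : Fin n) = 0 from by simp [ind, hjS],
          hzero _ (Finset.mem_sdiff.mpr ⟨hjA, hjS⟩), add_zero]
    · funext i
      exact (by decide : ∀ a b : ZMod 2, a + (a + b) = b) (ind S i) (x i)
  · rintro ⟨w, hw, rfl⟩
    have hwA : ∀ j ∈ A, w j = 0 := by
      intro j hj
      have := congrFun hw ⟨j, hj⟩
      rwa [LinearMap.funLeft_apply] at this
    constructor
    · intro j hj
      simp only [Pi.add_apply, ind, if_pos hj, hwA j (hSA hj), add_zero]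
    · intro j hj
      obtain ⟨hjA, hjS⟩ := Finset.mem_sdiff.mp hj
      simp only [Pi.add_apply, ind, if_neg hjS, hwA j hjA, add_zero]

/-- Non-vacuity: `ind S ∈ Φ_S`. [folklore] -/
lemma ind_mem_Phi (S : Finset (Fin n)) : ind S ∈ Phi S := by
  refine Finset.mem_filter.mpr ⟨Finset.mem_univ _, fun j hj => ?_⟩
  simp [ind, if_pos hj]

/-- The multiplicity-one witness: `ind S` lies in `Φ_{S'}` iff `S' ⊆ S`;
for `|S'| = |S|` this forces `S' = S`. [folklore] -/
lemma ind_mem_Phi_iff {S S' : Finset (Fin n)} : ind S ∈ Phi S' ↔ S' ⊆ S := by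
  rw [mem_Phi, supp_ind]

end CubeMiddleLayer

end Literature.Combinatorics.SetFamily
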